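import Literature.NumberTheory.Automorphic.JacquetGLGeneration
import Literature.NumberTheory.Automorphic.ParabolicInductionQuotientProofs
import Literature.NumberTheory.Automorphic.JacquetModuleExactProofs
import Literature.NumberTheory.Automorphic.UnipotentRadicalCompactOpenProofs
import Literature.NumberTheory.Automorphic.SmoothDualLevel
import HarnessLib

/-!
# Functoriality of the `GL_n` Jacquet module and generation by fixed vectors (set versions)

Plumbing for the finite-length theorem of parabolic induction on `GL_n(F)`:

* `jacquetGLMap f : r_c(ρ₁) → r_c(ρ₂)` for an intertwining map `f : ρ₁ → ρ₂` of representations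
  of `GL_n(F)` (`[v] ↦ [f v]`), surjective for `f` surjective and — for `c` monotone and `ρ₂`
  smooth — injective for `f` injective (`coinvariantsMap_injective_of_isLimitOfCompactOpen`,
  `isLimitOfCompactOpen_unipotentRadicalGL`; Bernstein–Zelevinsky 1977, Prop. 1.9 (a));
* small constructions on intertwining maps: the inverse `rangeInverse` of an injective map onto
  its range, the corestriction `codRestrictSubrep` to a subrepresentation containing the range;
* the cyclic subrepresentation `orbitSpan` is generated, as a representation, by its generator
  (`span_orbit_orbitSpan_eq_top`);
* set versions of `JacquetGLGeneration`: if `π` is spanned by the translates of a set `s ⊆ π^{K_γ}`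
  then `r_c(π)` is spanned over `L` by its `K^L_γ`-fixed vectors
  (`span_jacquetGL_fixedPoints_eq_top_of_subset`) and over `L°` by the vectors fixed by finitely
  many conjugates of `K^L_γ` (`exists_finset_span_leviDetOne_jacquetGL_fixedPoints_eq_top_of_subset`).

Definitions `jacquetGLMap`, `rangeInverse`, `codRestrictSubrep`; theorems otherwise; no named facts.

## References

* I. N. Bernstein, A. V. Zelevinsky, *Induced representations of reductive `p`-adic groups I*,
  Ann. Sci. ÉNS 10 (1977), Prop. 1.9, 2.3.
-/

noncomputable section

open scoped MatrixGroups Pointwise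

/-! ### Small constructions on intertwining maps -/

namespace Representation

section Maps

variable {k G V W : Type*} [CommRing k] [Monoid G] [AddCommGroup V] [Module k V]
  [AddCommGroup W] [Module k W] {ρ : Representation k G V} {σ : Representation k G W}

/-- **Corestriction** of an intertwining map to a subrepresentation containing its range. [folklore] -/
def IntertwiningMap.codRestrictSubrep (f : ρ.IntertwiningMap σ) (S : Subrepresentation σ)
    (hS : ∀ v, f v ∈ S) : ρ.IntertwiningMap S.toRepresentation where
  toLinearMap := LinearMap.codRestrict S.toSubmodule f.toLinearMap hS
  isIntertwining' g := by
    refine LinearMap.ext fun v => Subtype.ext ?_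
    change f (ρ g v) = σ g (f v)
    exact f.isIntertwining _ _ g v

/-- Unfolding lemma for the corestriction. [folklore] -/
@[simp] theorem IntertwiningMap.coe_codRestrictSubrep_apply (f : ρ.IntertwiningMap σ) (S : Subrepresentation σ)
    (hS : ∀ v, f v ∈ S) (v : V) : (f.codRestrictSubrep S hS v : W) = f v := rfl

/-- The corestriction of `f` to `S` is surjective when `S ≤ range f`. [folklore] -/
theorem IntertwiningMap.codRestrictSubrep_surjective (f : ρ.IntertwiningMap σ) (S : Subrepresentation σ)
    (hS : ∀ v, f v ∈ S) (h : ∀ w ∈ S, ∃ v, f v = w) : Function.Surjective (f.codRestrictSubrep S hS) := by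
  rintro ⟨w, hw⟩
  obtain ⟨v, hv⟩ := h w hw
  exact ⟨v, Subtype.ext hv⟩

/-- **The inverse of an injective intertwining map onto its range**, as an intertwining map
`range f → ρ`. [folklore] -/
def IntertwiningMap.rangeInverse {k : Type*} [Field k] [Module k V] [Module k W] {ρ : Representation k G V}
    {σ : Representation k G W} (f : ρ.IntertwiningMap σ) (hf : Function.Injective f) :
    f.range.toRepresentation.IntertwiningMap ρ where
  toLinearMap := (LinearEquiv.ofInjective f.toLinearMap hf).symm.toLinearMap
  isIntertwining' g := by
    refine LinearMap.ext fun w => hf ?_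
    obtain ⟨v, hv⟩ : ∃ v, f v = (w : W) := w.2
    have hw : w = (LinearEquiv.ofInjective f.toLinearMap hf) v := Subtype.ext hv.symm
    have hgw : f.range.toRepresentation g w = (LinearEquiv.ofInjective f.toLinearMap hf) (ρ g v) := by
      apply Subtype.ext
      change σ g (w : W) = f (ρ g v)
      rw [← hv, f.isIntertwining]
    change f ((LinearEquiv.ofInjective f.toLinearMap hf).symm (f.range.toRepresentation g w)) =
      f (ρ g ((LinearEquiv.ofInjective f.toLinearMap hf).symm w))
    rw [hgw, hw, LinearEquiv.symm_apply_apply, LinearEquiv.symm_apply_apply]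

/-- `f (rangeInverse f w) = w`. [folklore] -/
theorem IntertwiningMap.apply_rangeInverse {k : Type*} [Field k] [Module k V] [Module k W] {ρ : Representation k G V}
    {σ : Representation k G W} (f : ρ.IntertwiningMap σ) (hf : Function.Injective f) (w : f.range.toSubmodule) :
    f (f.rangeInverse hf w) = (w : W) := by
  obtain ⟨v, hv⟩ : ∃ v, f v = (w : W) := w.2
  have hw : w = (LinearEquiv.ofInjective f.toLinearMap hf) v := Subtype.ext hv.symm
  change f ((LinearEquiv.ofInjective f.toLinearMap hf).symm w) = _
  rw [hw, LinearEquiv.symm_apply_apply]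
  rfl

/-- `rangeInverse f` is surjective. [folklore] -/
theorem IntertwiningMap.rangeInverse_surjective {k : Type*} [Field k] [Module k V] [Module k W]
    {ρ : Representation k G V} {σ : Representation k G W} (f : ρ.IntertwiningMap σ) (hf : Function.Injective f) :
    Function.Surjective (f.rangeInverse hf) := fun v =>
  ⟨(LinearEquiv.ofInjective f.toLinearMap hf) v, by
    change (LinearEquiv.ofInjective f.toLinearMap hf).symm _ = v
    rw [LinearEquiv.symm_apply_apply]⟩

end Maps

section Cyclic

variable {k G V : Type*} [Field k] [Group G] [AddCommGroup V] [Module k V] (ρ : Representation k G V)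

/-- `v ∈ orbitSpan ρ v`. [folklore] -/
theorem mem_orbitSpan_self (v : V) : v ∈ ρ.orbitSpan v :=
  ⟨Finsupp.single 1 1, by simp⟩

/-- The cyclic subrepresentation `orbitSpan ρ v` is the span of the orbit of `v`. [folklore] -/
theorem orbitSpan_toSubmodule (v : V) :
    (ρ.orbitSpan v).toSubmodule = Submodule.span k (Set.range fun g : G => ρ g v) := by
  change LinearMap.range (ρ.orbitCombination v) = _
  rw [orbitCombination, Finsupp.range_linearCombination]

/-- **A cyclic subrepresentation is generated by its generator**: in `orbitSpan ρ v`, the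
translates of `⟨v, _⟩` span everything. [folklore] -/
theorem span_orbit_orbitSpan_eq_top (v : V) :
    Submodule.span k (Set.range fun g : G => (ρ.orbitSpan v).toRepresentation g ⟨v, ρ.mem_orbitSpan_self v⟩) = ⊤ := by
  apply Submodule.map_injective_of_injective (ρ.orbitSpan v).toSubmodule.injective_subtype
  rw [Submodule.map_span, Submodule.map_top, Submodule.range_subtype]
  have : ((ρ.orbitSpan v).toSubmodule.subtype '' Set.range fun g : G =>
      (ρ.orbitSpan v).toRepresentation g ⟨v, ρ.mem_orbitSpan_self v⟩) = Set.range fun g : G => ρ g v := by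
    rw [← Set.range_comp]
    rfl
  rw [this]
  exact (orbitSpan_toSubmodule ρ v).symm

end Cyclic

end Representation

/-! ### Functoriality of `r_c` -/

namespace Literature.NumberTheory.Automorphic

open Representation ValuativeRel

section Functor

variable (F : Type*) [Field F] [ValuativeRel F] [TopologicalSpace F] [IsNonarchimedeanLocalField F]
  {n r : ℕ} (c : Fin n → Fin r) {V₁ V₂ : Type*} [AddCommGroup V₁] [Module ℂ V₁] [AddCommGroup V₂] [Module ℂ V₂]
  {ρ₁ : Representation ℂ (GL (Fin n) F) V₁} {ρ₂ : Representation ℂ (GL (Fin n) F) V₂}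

/-- **Functoriality of the `GL_n` Jacquet module**: `f : ρ₁ → ρ₂` induces
`r_c(f) : r_c(ρ₁) → r_c(ρ₂)`, `[v] ↦ [f v]`. (Bernstein–Zelevinsky 1977, §1.8.) [folklore] -/
def jacquetGLMap (f : ρ₁.IntertwiningMap ρ₂) : (jacquetGL F c ρ₁).IntertwiningMap (jacquetGL F c ρ₂) where
  toLinearMap := Coinvariants.map (restrictUnipotentGL F c ρ₁) (restrictUnipotentGL F c ρ₂)
    ⟨f.toLinearMap, fun _ => f.isIntertwining' _⟩
  isIntertwining' m := by
    refine Coinvariants.hom_ext (LinearMap.ext fun v => ?_)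
    simp [f.isIntertwining]

variable {F c}

omit [ValuativeRel F] [TopologicalSpace F] [IsNonarchimedeanLocalField F] in
/-- `r_c(f) [v] = [f v]`. [folklore] -/
@[simp] theorem jacquetGLMap_mk (f : ρ₁.IntertwiningMap ρ₂) (v : V₁) :
    jacquetGLMap F c f (Coinvariants.mk (restrictUnipotentGL F c ρ₁) v) =
      Coinvariants.mk (restrictUnipotentGL F c ρ₂) (f v) := rfl

omit [ValuativeRel F] [TopologicalSpace F] [IsNonarchimedeanLocalField F] in
/-- `r_c(f)` is surjective when `f` is. [folklore] -/
theorem jacquetGLMap_surjective (f : ρ₁.IntertwiningMap ρ₂) (hf : Function.Surjective f) :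
    Function.Surjective (jacquetGLMap F c f) := by
  intro x
  obtain ⟨w, rfl⟩ := Coinvariants.mk_surjective _ x
  obtain ⟨v, rfl⟩ := hf w
  exact ⟨Coinvariants.mk _ v, rfl⟩

/-- **`r_c` preserves injections** (`c` monotone, `ρ₂` smooth): left exactness of coinvariants
for the union of compact open subgroups `U_c`. [cite: BernsteinZelevinsky1977, Prop. 1.9 (a)] -/
theorem jacquetGLMap_injective (hc : Monotone c) (h₂ : ρ₂.IsSmooth) (f : ρ₁.IntertwiningMap ρ₂)
    (hf : Function.Injective f) : Function.Injective (jacquetGLMap F c f) := by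
  haveI : IsTopologicalRing F := inferInstance
  have hinj := jacquetMap_injective (parabolicTripleGL F c) (isLimitOfCompactOpen_unipotentRadicalGL F c hc) h₂ f hf
  intro x y hxy
  apply EquivLike.injective (jacquetGLEquiv F c ρ₁)
  apply hinj
  obtain ⟨v, rfl⟩ := Coinvariants.mk_surjective _ x
  obtain ⟨w, rfl⟩ := Coinvariants.mk_surjective _ y
  exact congrArg (jacquetGLEquiv F c ρ₂) hxy

end Functor

/-! ### Generation of `r_c(π)` by fixed vectors: set versions -/

section Generation

variable {F : Type*} [Field F] [ValuativeRel F] [TopologicalSpace F] [IsNonarchimedeanLocalField F]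
  {n r : ℕ} {c : Fin n → Fin r} (hc : Monotone c) {V : Type*} [AddCommGroup V] [Module ℂ V]
  (π : Representation ℂ (GL (Fin n) F) V)

include hc in
omit [TopologicalSpace F] [IsNonarchimedeanLocalField F] in
/-- Set version of `span_jacquetGL_fixedPoints_eq_top`: if the translates of a set `s ⊆ π^{K_γ}`
span `V`, then `r_c(π)` is spanned by `{r_c(π)(l) z : l ∈ L, z ∈ r_c(π)^{K^L_γ}}`. [folklore] -/
theorem span_jacquetGL_fixedPoints_eq_top_of_subset {γ : ValueGroupWithZero F} {s : Set V}
    (hs : s ⊆ π.fixedPoints (congruenceGL n γ))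
    (hgen : Submodule.span ℂ {w | ∃ g : GL (Fin n) F, ∃ f ∈ s, w = π g f} = ⊤) :
    Submodule.span ℂ {x | ∃ l : (Π a, GL {i // c i = a} F),
      ∃ z ∈ (jacquetGL F c π).fixedPoints ((congruenceGL n γ).comap (blockDiagonalGL F c)),
        x = jacquetGL F c π l z} = ⊤ := by
  set S := Submodule.span ℂ {x | ∃ l : (Π a, GL {i // c i = a} F),
      ∃ z ∈ (jacquetGL F c π).fixedPoints ((congruenceGL n γ).comap (blockDiagonalGL F c)),
        x = jacquetGL F c π l z} with hS
  have hfix : ∀ w ∈ π.fixedPoints (congruenceGL n γ), Coinvariants.mk (restrictUnipotentGL F c π) w ∈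
      (jacquetGL F c π).fixedPoints ((congruenceGL n γ).comap (blockDiagonalGL F c)) := by
    intro w hw
    rw [mem_fixedPoints] at hw ⊢
    intro k hk
    rw [jacquetGL_mk, hw _ (Subgroup.mem_comap.1 hk)]
  have horb : ∀ (g : GL (Fin n) F), ∀ f ∈ s, Coinvariants.mk (restrictUnipotentGL F c π) (π g f) ∈ S := by
    intro g f hf
    have hf₀ : f ∈ π.fixedPoints (congruenceGL n γ) := hs hf
    obtain ⟨p, hp, k₀, hk₀, rfl⟩ := exists_standardParabolicGL_mul_glInt F hc g
    have hk₀f : π k₀ f ∈ π.fixedPoints (congruenceGL n γ) := by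
      rw [mem_fixedPoints] at hf₀ ⊢
      intro k hk
      have hconj : k₀⁻¹ * k * k₀ ∈ congruenceGL n γ := by
        have := conj_mem_congruenceGL (Subgroup.inv_mem _ hk₀) hk
        rwa [inv_inv] at this
      calc π k (π k₀ f) = π k₀ (π (k₀⁻¹ * k * k₀) f) := by
            rw [← Module.End.mul_apply, ← Module.End.mul_apply, ← map_mul, ← map_mul, ← mul_assoc, ← mul_assoc,
              mul_inv_cancel, one_mul]
        _ = π k₀ f := by rw [hf₀ _ hconj]
    rw [map_mul, Module.End.mul_apply, ← jacquetGL_leviProjection_mk F c π ⟨p, hp⟩ (π k₀ f)]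
    exact Submodule.subset_span ⟨_, _, hfix _ hk₀f, rfl⟩
  refine eq_top_iff.2 fun x _ => ?_
  obtain ⟨v, rfl⟩ := Coinvariants.mk_surjective _ x
  have hv : v ∈ Submodule.span ℂ {w | ∃ g : GL (Fin n) F, ∃ f ∈ s, w = π g f} := by rw [hgen]; trivial
  refine Submodule.span_induction (p := fun w _ => Coinvariants.mk (restrictUnipotentGL F c π) w ∈ S)
    ?_ ?_ ?_ ?_ hv
  · rintro _ ⟨g, f, hf, rfl⟩
    exact horb g f hf
  · rw [map_zero]; exact S.zero_mem
  · intro a b _ _ ha hb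
    rw [map_add]; exact S.add_mem ha hb
  · intro a w _ hw
    rw [map_smul]; exact S.smul_mem a hw

include hc in
/-- Set version of `exists_finset_span_leviDetOne_jacquetGL_fixedPoints_eq_top`: generation of
`r_c(π)` over `L°` by the vectors fixed by finitely many conjugates `l K^L_γ l⁻¹`, `l ∈ R`. [folklore] -/
theorem exists_finset_span_leviDetOne_jacquetGL_fixedPoints_eq_top_of_subset {γ : ValueGroupWithZero F}
    {s : Set V} (hs : s ⊆ π.fixedPoints (congruenceGL n γ))
    (hgen : Submodule.span ℂ {w | ∃ g : GL (Fin n) F, ∃ f ∈ s, w = π g f} = ⊤) :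
    ∃ R : Finset (Π a, GL {i // c i = a} F),
      Submodule.span ℂ {x | ∃ h ∈ leviDetOne F c, ∃ l : (R : Set (Π a, GL {i // c i = a} F)),
        ∃ z ∈ (jacquetGL F c π).fixedPoints
          (((congruenceGL n γ).comap (blockDiagonalGL F c)).map (MulAut.conj (l : Π a, GL {i // c i = a} F)).toMonoidHom),
        x = jacquetGL F c π h z} = ⊤ := by
  obtain ⟨R, hR⟩ := exists_finset_forall_eq_leviDetOne_mul_mul_center (F := F) c
  refine ⟨R, ?_⟩
  rw [eq_top_iff, ← span_jacquetGL_fixedPoints_eq_top_of_subset hc π hs hgen]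
  refine Submodule.span_le.2 ?_
  rintro _ ⟨l, z, hz, rfl⟩
  obtain ⟨h, hh, l', hl', zc, hzc, rfl⟩ := hR l
  rw [map_mul, map_mul, Module.End.mul_apply, Module.End.mul_apply]
  exact Submodule.subset_span ⟨h, hh, ⟨l', hl'⟩, _,
    apply_mem_fixedPoints_map_conj _ l' (apply_mem_fixedPoints_of_mem_center _ hzc hz), rfl⟩

end Generation

end Literature.NumberTheory.Automorphic
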